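import Literature.NumberTheory.EllipticCurves.CMNewformOfHeckeCharacter
import Literature.NumberTheory.EllipticCurves.BDPAnticyclotomicPAdicLFunction
import Literature.NumberTheory.EllipticCurves.Rubin1991.TwoVariableMainConjecture
import Literature.NumberTheory.EllipticCurves.HeckeOperators
import Literature.NumberTheory.EllipticCurves.PAdicLFunction
import Literature.NumberTheory.EllipticCurves.Rank1Residual.Predicates
import Literature.NumberTheory.GaloisRepresentations.HeckeCharacterNormCharacter
import HarnessLib

/-!
# Castella–Grossi–Skinner, Math. Ann. 393 (2025), §2.4 "Two-variable `p`-adic `L`-function, II":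
# Theorem 2.4.1 — Hida's type-II′ two-variable `p`-adic Rankin `L`-series `𝓛_p(f/K, Σ^{(2′)})`
# (= Lei–Loeffler–Zerbes 2015, Thm. 6.1.3 (ii) with `v ↔ v̄`): its CHARACTERISING PREDICATE
# `IsHidaRankinLFunctionII` and ONE named existence fact

Source of record: F. Castella, G. Grossi, C. Skinner, *Mazur's main conjecture at Eisenstein
primes*, Math. Ann. **393** (2025) 2451–2506 = arXiv:2303.04373v2 (bib key
`CastellaGrossiSkinner2025`); locators are the line numbers of the accepted TeX
(`run/shared/lean/b2b/bsd-rank1-residual/b2b-bsdres-lit-cgls/src/cgs25-final/Mazur-paper_revised.tex`,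
printed numbering `\newtheorem{thm}[subsection]`), concordance with the store text of arXiv v1
(`paper:arxiv-2303.04373`, where print §2.4 = v1 §1.4: Thm. 2.4.1 = v1 Thm. 1.4.1,
[corpus: paper:arxiv-2303.04373 p0009:L1–L15], identical wording). Cell `pub/bsd-littype`
(cross-ladder literature-typing layer D-0088(4)), seat `bsd-littype-02` gen 3. This file types the
ONE carrier three typing seats recorded as missing for every Greenberg-side two-variable statement
over `K_∞` (`YanZhu2026/TwoVariableMainTheorems.lean`, GAP note: "the ONE missing carrier is Hida's
type-II function `𝓛_p^II` (Thm. 3.9 = [CGS, Thm. 2.4.1] = [LLZ15, Thm. 6.1.3])";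
`BurungaleCastellaSkinner2025/TwoVariableMainTheorem.lean` and `…/BDPMainConjecture.lean`, GAP
notes on `L_p^Gr`; `pub/bsd-littype/INBOX.md` 2026-08-26T20:29:04Z (ii)): the consumers are
Yan–Zhu 2026 statement 4.1 (2) / Thm. 4.2 (2) / Thm. 4.7 / Cor. 5.4, Burungale–Castella–Skinner
2025 Conj. 4.1.2 / Thm. 1.4.1 (b) / Prop. 4.2.2, and CGS's own Def. 2.4.3 (`𝓛_p^Gr := h_K ·
𝓛_v(K)⁻ · 𝓛_p(f/K, Σ^{(2′)})`), Lemma 2.4.4, Prop. 2.4.5 and Conj. 3.2.2 (Greenberg), second line.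

## The printed statements (verbatim)

CGS §2 standing (l.697–705): "Let `E/ℚ` be an elliptic curve of conductor `N`, and let `p ∤ 2N` be a
prime of good ordinary reduction for `E`. Fix embeddings `ι_p : ℚ̄ ↪ ℚ̄_p` and `ι_∞ : ℚ̄ ↪ ℂ`. Let `K`
be an imaginary quadratic field of discriminant `D_K < 0` prime to `N`, and assume that (spl)
`(p) = v v̄` splits in `K`, with `v` the prime above `p` induced by `ι_p`. We denote by … `Γ_K` the
Galois group of … the `ℤ_p²`-extension `K_∞/K` … `Λ_K = ℤ_p⟦Γ_K⟧`." §2.2 (l.776–781): "Let `Σ` be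
the set of infinity types of Hecke characters `ψ` of `K` for which `s = 1` is a critical value of the
Rankin `L`-function `L(f/K, ψ, s)`. Following the notations and conventions in [LLZ-K, §6.1], the set
`Σ` decomposes as `Σ = Σ^{(1)} ∪ Σ^{(2)} ∪ Σ^{(2′)}`, where `Σ^{(1)} = {(0,0)}` …,
`Σ^{(2)} = {(a,b) : a ≤ −1, b ≥ 1}`, and `Σ^{(2′)} = {(b,a) : a ≤ −1, b ≥ 1}`. … the regions
`Σ^{(2)}` and `Σ^{(2′)}` are interchanged by the involution `ψ ↦ ψ^τ`, where `ψ^τ` denotes the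
composition of `ψ` with the non-trivial automorphism `τ ∈ Gal(K/ℚ)`." Thm. 2.2.1 (l.813):
"`⟨f,g⟩_N = ∫_{Γ₀(N)\𝓗} \overline{f(τ)} g(τ) dx dy` is the Petersson inner product on
`S_2(Γ₀(N))`"; "`α_p` … the `p`-adic unit root of `x² − a_p x + p`" (l.732).

**Theorem 2.4.1** (`thm:Gr`, l.942–960). "There exists an element `𝓛_p(f/K, Σ^{(2′)}) ∈ Frac Λ_K`
such that for every character `ξ` of `Γ_K` crystalline at both `v` and `v̄`, and of infinity type
`(b, a)` with `a ≤ −1` and `b ≥ 1`, we have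
`𝓛_p(f/K, Σ^{(2′)})(ψ) = [2^{a−b} i^{b−a−1} Γ(b+1) Γ(b) N^{a+b+1}] / [(2π)^{2b+1}
⟨θ_{ψ_b}, θ_{ψ_b}⟩_N] · 𝓔(ψ, f, 1) / [(1 − ψ^{1−τ}(v̄))(1 − p⁻¹ ψ^{1−τ}(v̄))] · L(f/K, ψ, 1)`, where
`θ_{ψ_b}` is the theta series of weight `b − a + 1 ≥ 3` associated to the Hecke character
`ψ_b = ψ|·|^{−b}` of ∞-type `(0, a − b)`, and `𝓔(ψ, f, 1) = (1 − p⁻¹ψ(v̄)α_p)(1 − ψ(v̄)α_p⁻¹)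
(1 − ψ⁻¹(v)α_p⁻¹)(1 − p⁻¹ψ⁻¹(v)α_p)`." Proof (l.957–959): "This is another instance of Hida's `p`-adic
Rankin `L`-series, as explained in [LLZ-K, Thm. 6.1.3] (note, however, that we have reversed the
roles of `v` and `v̄` with respect to loc. cit.)."

**Lei–Loeffler–Zerbes, Compositio 151 (2015), Thm. 6.1.3 (ii)** ([corpus: paper:arxiv-1311.0175
p0014:L26–L44], bib key `LeiLoefflerZerbes2015`): "Assume `(N_f, N_ψ) = 1`, where `N_ψ =
N_{K/ℚ}(𝔠) · |disc|` as usual, and let `N` be an integer divisible by `N_f N_ψ` and having the same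
prime factors as `N_f N_ψ`. … Suppose `p` is split in `K`. Then there exists an element
`L_p(f/K, Σ^{(2)}) ∈ Λ_E(H_{𝔠p^∞})` with the property that for Grössencharacters `ψ` of `K` of
conductor dividing `𝔠` and infinity-type `(a,b) ∈ Σ^{(2)}`, we have `L_p(f/K, Σ^{(2)})(ψ_p) = 𝓔(ψ,f,1)
/ [(1 − ψ(𝔭)/ψ(𝔭̄))(1 − ψ(𝔭)/(p ψ(𝔭̄)))] · [2^{a−b} i^{b−a−1} b!(b−1)! N^{a+b+1}] / [(2π)^{1+2b}
⟨g_λ, g_λ⟩_N] · L(f/K, ψ, 1)`, where … `g_λ` is the CM eigenform of level `N_ψ` and weight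
`1 − a + b ≥ 3` corresponding to the Grössencharacter `λ = ψ|·|^{−b}` of ∞-type `(a − b, 0)`."
(§3.1, [corpus: paper:arxiv-1311.0175 p0006:L7–L13]: a Grössencharacter of infinity-type `(−1, 0)`
gives the weight-two CM form `Σ ψ(𝔞) q^{N𝔞}`, i.e. `ψ((α)) = α`: LLZ's — hence CGS's — infinity type
`(a, b)` means `ψ((α)) = α^{−a} ᾱ^{−b}` on `α ≡ 1`, i.e. `ψ_∞(z) = z^{a} z̄^{b}`, and `|·|` (the idelic
norm, `|𝔞| = N𝔞⁻¹`) has type `(1, 1)`.)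

## Transcription (tree vocabulary only; every device below is a READING, flagged where a choice is made)

* `Γ_K`, `Λ_K`, the two variables: an adapted generator pair `(κ₁, κ₂; γ₁, γ₂)` of `ℤ_p`-extensions
  of `K` (`ZpExtension.IsTopGeneratorPair`; `K̃_∞ = K̄^{pairKer κ₁ κ₂}` IS the `ℤ_p²`-extension, unique
  for `K` imaginary quadratic); `Λ_K = IwasawaAlgebra₂ p = ℤ_p⟦T₂⟧⟦T₁⟧`, `1 + T_i ↔ γ_i`
  (`Rubin1991/TwoVariableMainConjecture.lean`); values in `ℂ_p` are read in the receptacle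
  `𝒪_{ℂ_p}⟦T₁⟧⟦T₂⟧ = PowerSeries (PowerSeries (PadicComplexInt p))` through
  `IntSeries.HasValueAt₂` — the currency of the Katz frame `IsKatzMeasure₂` (the other factor of
  CGS's `𝓛_p^Gr`) and of Rubin's two-variable facts.
* "`∈ Frac Λ_K`": a PAIR `(H, G)` of elements of `Λ_K` with `H ≠ 0`, `𝓛 = G/H`; the interpolation
  property reads `G(ψ) = H(ψ) · RHS(ψ)` (both values through `HasValueAt₂`; `H ∈ Λ_K` converges on
  the open bidisc). Nothing is claimed about integrality of `𝓛` itself (CGS prove `H_𝐠^cusp · 𝓛 ∈ Λ_K`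
  only inside Lemma 2.4.4's proof). `Λ_K ↪ 𝒪_{ℂ_p}⟦T₁,T₂⟧` along every structure-compatible
  `J : ℤ_p →+* 𝒪_{ℂ_p}` (the idiom of `Rubin1991.thm41_exists_katzMeasure₂_charIdeal_eq`).
* "character `ξ` of `Γ_K` crystalline at `v` and `v̄`, of infinity type `(b, a)`, `a ≤ −1`, `b ≥ 1`"
  (the display then writes `ψ` for `ξ`): an idelic Hecke character `ψ : HeckeCharacter K` with
  `ψ.HasInfinityType (fun _ ↦ −b) (fun _ ↦ c)`, `1 ≤ b`, `1 ≤ c` (`c := −a`; the tree's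
  `HasInfinityType p q` means `ψ_∞(z) = z^{−p} z̄^{−q}` at the unique complex place, module docstring of
  `AlgebraicHeckeCharacterGrossencharakterProofs.lean`, so LLZ/CGS type `(b, a)` is tree type
  `(−b, −a)`), UNRAMIFIED AT EVERY FINITE PLACE (a character of `Γ_K` is unramified outside `p`;
  "crystalline at `v`, `v̄`" for the `p`-adic avatar of an algebraic Hecke character is "conductor
  prime to `p`"; together: conductor `1`), together with its `p`-adic avatar
  `r : Γ_K → GL₁(ℚ̄_p)` (`IsPAdicAvatarOf ι ψ r`, the geometric normalisation of
  `BDPAnticyclotomicPAdicLFunction.lean`) factoring through the pair (`FactorsThroughPair κ₁ κ₂ r`);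
  "`𝓛(ψ)`" is the value at `(T₁, T₂) = (r(γ₁) − 1, r(γ₂) − 1)` (`avatarValueAt`) — READING FLAG
  `CGS-241-orientation`: the orientation (avatar of `ψ`, not of `ψ⁻¹`; geometric Frobenii) is that
  of the tree's `IsBDPLFunction` / `IsKatzMeasure₂`; the source does not spell it out.
* `ψ_b = ψ|·|^{−b}` = `ψ * (HeckeCharacter.normCharacter K ^ b)⁻¹` (tree type `(0, b + c)` =
  LLZ `(0, a − b)`); "`θ_{ψ_b}`, the theta series of weight `b − a + 1` associated to `ψ_b`" = a CM
  NEWFORM `θ ∈ S_{b+c+1}(Γ₁(M))` of `ψ_b` in the sense of the tree's Hecke–Shimura–Ribet fact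
  `ModularForms.Ribet1977_cmNewform_of_heckeCharacter` — the matching predicate is named here
  `ModularForms.IsCMNewformOf ψ_b M k θ` (newform on `Γ₁(M)` whose Hecke polynomial at every
  `ℓ ∤ M` is `∏_{w ∣ ℓ}(X^{f_w} − ψ_b(ϖ_w))`); for `ψ` of conductor `1` the level is `M = |D_K|`
  (Shimura; not used). The display's "`N`" in `N^{a+b+1}` and `⟨θ_{ψ_b}, θ_{ψ_b}⟩_N` — READING FLAG
  `CGS-241-level`: in CGS §2, `N = N_E`, but `θ_{ψ_b}` has level `|D_K| ∤ N_E`, so `⟨θ, θ⟩_{N_E}` on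
  `S_k(Γ₀(N_E))` (the pairing of Thm. 2.2.1) is not defined for it; the cited source LLZ15 6.1.3 takes
  for `N` ANY integer divisible by `N_f N_ψ` with the same prime factors, consistently in both places.
  We read `N := N_f · M` (the least admissible choice; any two admissible choices change the
  right-hand side by `m^{a+b}` for an integer `m` prime to `p`, a value interpolated by a unit of
  `Λ_K`, so the IDEALS downstream do not depend on it — not formalised).
* `⟨θ, θ⟩_N = ∫_{Γ₀(N)\ℍ} |θ|² y^{k−2} dx dy` (CGS l.813, Hida's un-normalised pairing at level `N`),
  for `θ` on `Γ₁(M)`, `M ∣ N`, whose `|θ|² y^k` is `Γ₀(M)`-invariant: `= [Γ₀(M) : Γ₀(N)] ·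
  ∫_{Γ₀(M)\ℍ} = ([SL₂(ℤ) : Γ₀(N)] / [SL₂(ℤ) : Γ₁(M)]) · peterssonProduct (Gamma1 M) k θ θ`, using the
  tree's `peterssonProduct Γ k f g = [±Γ : Γ] ∫_{Γ\ℍ} f̄ g y^k dμ` (module docstring of
  `HeckeOperators.lean`: no volume normalisation, twice the orbifold integral when `−1 ∉ Γ`) and
  `[Γ₀(M) : Γ₁(M)] = [Γ₀(M) : ±Γ₁(M)] · [±Γ₁(M) : Γ₁(M)]`. This is `hidaPeterssonNorm N θ` below
  (a definition with a body; indices `Subgroup.index` in `SL(2, ℤ)`).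
* `2^{a−b} = 2^{−(b+c)}`, `i^{b−a−1} = i^{b+c−1}`, `Γ(b+1)Γ(b) = b!(b−1)!`, `N^{a+b+1} = N^{b−c+1}`
  (an integer power, possibly negative), `(2π)^{2b+1}`; `ψ(v̄) = ψ.valueAtUniformizer v̄`, `ψ(v)`
  likewise (independent of the uniformizer: `ψ` is unramified), `ψ^{1−τ}(v̄) = ψ(v̄)/ψ^τ(v̄) =
  ψ(v̄)/ψ(v)` (`τ v̄ = v`), `ψ⁻¹(v) = ψ(v)⁻¹`; `α_p ∈ ℂ` is the image under the embedding datum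
  `ι : ℚ̄_p ≃ ℂ` (`= ι_∞ ∘ ι_p⁻¹`) of the tree's `p`-adic unit root `unitRoot W p ∈ ℤ_p` of the
  globally minimal model `W` of `E`; the whole right-hand side is formed in `ℂ` and transported by
  `ι⁻¹` into `ℚ̄_p ⊂ ℂ_p` (as in `IsBDPLFunction`, `IsKatzMeasure₂`).
* `L(f/K, ψ, 1)`: the value at `s = 1` of an ENTIRE CONTINUATION `L` of the Euler product
  `rankinSelbergEulerProductHecke f ψ s = ∏_w [(1 − α_{Nw} ψ(ϖ_w) Nw^{−s})(1 − β_{Nw} ψ(ϖ_w) Nw^{−s})]⁻¹`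
  (`BDPAnticyclotomicPAdicLFunction.lean`, Nekovář (0.5) / Castella–Hsieh §3.3 "`L(s, π_K ⊗ χ)`"),
  demanded to agree with the product on `re s > c + 2`, where it converges absolutely
  (`|ψ(ϖ_w)| = Nw^{(c−b)/2}`, `|α_{Nw}| ≤ Nw^{1/2}`): the binder `∀ L, Differentiable ℂ L → (agreement)
  → …` (the shape of the `hL` binder of `IsKatzMeasure₂`); the tree's ready-made value
  `rankinSelbergValueHecke f ψ 1` is NOT used because it fixes the half-plane `re s > 3/2`, which is
  too large for non-unitary `ψ` with `c > b`. If no entire continuation existed the clause would be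
  vacuous (it exists: Rankin–Selberg; not asserted here).

FAITHFULNESS: `IsHidaRankinLFunctionII` transcribes the displayed interpolation formula symbol by
symbol under the readings above (flags `CGS-241-level`, `CGS-241-orientation`); the named fact
`thm241_exists_isHidaRankinLFunctionII` is the printed existence "`∈ Frac Λ_K`" with the §2 standing
hypotheses as binders and `v` "induced by `ι_p`" as the compatibility clause of
`castella2018_exists_isBDPLFunction` / `Rubin1991.thm41_…` (`k ∈ v ↔ ‖ι⁻¹(k)‖ < 1` through Mathlib's
embedding of the infinite place — the embedding through which `HasInfinityType` is read). WEAKER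
than print only in that the formula is demanded at characters unramified EVERYWHERE (= the printed
range for characters of `Γ_K`, see above) and for CM newforms `θ` of `ψ_b` at whatever level `M`
they occur (print: "the" theta series). Not STRONGER than print anywhere. PUBLISHED (Math. Ann.);
the proof is a citation of LLZ15 (published) — no preprint input. ERRATA recorded for the cell
(`pub/bsd-littype/OPEN-QUESTIONS-02.md` E2): the hypothesis names the character `ξ`, the display
`ψ`; the letter `N` is overloaded (above).

NOT typed here (GAP, precise reasons in `pub/bsd-littype/staging/bsd-littype-02/SHEETS-02.md`
§GEN-3): Thm. 2.4.2 (Katz) — the tree's `IsKatzMeasure₂ ι v v̄ …` IS CGS's `𝓛_v̄(K)` (de Shalit's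
`μ(v̄^∞)`: characters of type `(k, j)`, `0 ≤ −j < k`, unramified at `v`), cited by name, not
restated; CGS's second measure `𝓛_v(K) = μ(v^∞)` (type `(j, k)`) has no tree frame (the
infinity-type slots of `IsKatzMeasure₂` are fixed through Mathlib's embedding of the infinite place),
hence Def. 2.4.3 (`𝓛_p^Gr := h_K · 𝓛_v(K)⁻ · 𝓛_p(f/K, Σ^{(2′)})`, `γ ↦ γ^{1−τ}`), Lemma 2.4.4
(`𝓛_p^Gr ∈ Λ_K^ur`) and Prop. 2.4.5 (`𝓛_p^Gr(f/K)⁻ · Λ_K^{−,ur} = 𝓛_p^BDP(f/K) · Λ_K^{−,ur}`) wait for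
a conjugate Katz frame; nothing of them is asserted here.

## References
* [CastellaGrossiSkinner2025] F. Castella, G. Grossi, C. Skinner, Math. Ann. 393 (2025) 2451–2506
  = arXiv:2303.04373v2: §2 (l.697–715), Thm. 2.2.1 (l.795–814, `⟨,⟩_N`), §2.2 conventions
  (l.776–781), **Thm. 2.4.1** (l.942–960) = v1 Thm. 1.4.1 [corpus: paper:arxiv-2303.04373 p0009:L1–L15],
  Def. 2.4.3 / Lemma 2.4.4 / Prop. 2.4.5 (l.983–1055).
* [LeiLoefflerZerbes2015] A. Lei, D. Loeffler, S. L. Zerbes, Compositio Math. 151 (2015) 1585–1625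
  = arXiv:1311.0175: §3.1 Thm. 3.1.1 [corpus: paper:arxiv-1311.0175 p0006:L7–L13], §6.1 and
  **Thm. 6.1.3 (ii)** [corpus: paper:arxiv-1311.0175 p0014:L7–L44].
* [Ribet1977Nebentypus] K. Ribet, LNM 601 (1977) §3 — tree `ModularForms.Ribet1977_cmNewform_of_heckeCharacter`.
* H. Hida, Invent. Math. 79 (1985) (the `p`-adic Rankin method; CGS's [hida-measure-I]).
-/

noncomputable section

open scoped MatrixGroups ModularForm NumberField
open CongruenceSubgroup NumberField IsDedekindDomain Field Polynomial
open Literature.NumberTheory.GaloisRepresentations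
open Literature.NumberTheory.EllipticCurves.ModularForms

/-! ## §A. The CM newform of a Hecke character: the matching predicate behind Ribet's fact -/

namespace Literature.NumberTheory.EllipticCurves.ModularForms

variable {K : Type} [Field K] [NumberField K]

/-- **`g ∈ S_k(Γ₁(M))` is a CM newform of the Hecke character `ψ` of the quadratic field `K`**
(Hecke–Shimura; Ribet 1977, §3, Thm. (3.4), Cor. (3.5)): `g` is a newform of level `Γ₁(M)`
(`IsNewform1`) and at every rational prime `ℓ ∤ M` — read as a place `v` of `ℚ`, `ℓ = primesEquiv v` —
`ℓ` is unramified in `K`, `ψ` is unramified at the places `w ∣ ℓ` of `K`, and the Hecke polynomial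
`X² − a_ℓ(g) X + ε(ℓ) ℓ^{k−1}` of `g` (`heckePolynomial`, mapped to `ℂ[X]`) is
`∏_{w ∣ ℓ} (X^{f(w|ℓ)} − ψ(ϖ_w))` (`inducedFrobPolynomial`) — i.e. `a_ℓ(g) = ψ(𝔩) + ψ(𝔩̄)` at a split
`ℓ = 𝔩𝔩̄` and `a_ℓ(g) = 0` at an inert `ℓ`: the identity `L(g, s) = L(ψ, s)` Euler factor by Euler
factor. VERBATIM the conclusion of the tree's named fact `Ribet1977_cmNewform_of_heckeCharacter`
for a GIVEN level `M` and form `g`, so that the fact reads "`∃ M g, IsCMNewformOf ψ M k g`"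
(`exists_isCMNewformOf`). This is the tree's spelling of "the theta series `θ_ψ` associated to the
Hecke character `ψ`" (CGS Thm. 2.4.1; LLZ15 Thm. 3.1.1 / 6.1.3: "the CM eigenform `g_λ` … corresponding
to the Grössencharacter `λ`"). [cite: Ribet1977Nebentypus, §3, Thm. (3.4), Cor. (3.5) and Remark (3.5) (LNM 601, pp. 34–35)]
[cite: LeiLoefflerZerbes2015, Thm. 3.1.1 (arXiv:1311.0175 §3.1)] -/
def IsCMNewformOf (ψ : HeckeCharacter K) (M : ℕ) [NeZero M] (k : ℕ)
    (g : CuspForm (Gamma1 M) (k : ℤ)) : Prop :=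
  IsNewform1 g ∧
    ∀ v : HeightOneSpectrum (𝓞 ℚ),
      ¬ ((Rat.HeightOneSpectrum.primesEquiv v : Nat.Primes) : ℕ) ∣ M →
      v.asIdeal.ramificationIdxIn (𝓞 K) = 1 ∧
      (∀ w : HeightOneSpectrum (𝓞 K), w.asIdeal.under (𝓞 ℚ) = v.asIdeal → ψ.IsUnramifiedAt w) ∧
      (heckePolynomial g (Rat.HeightOneSpectrum.primesEquiv v : Nat.Primes)).map
          (algebraMap (coeffCharField g) ℂ) =
        inducedFrobPolynomial v (fun w => X - C (ψ.valueAtUniformizer w))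

/-- A CM newform of `ψ` is a newform. [cite: Ribet1977Nebentypus, §3, Cor. (3.5) and Remark (3.5)] -/
theorem IsCMNewformOf.isNewform1 {ψ : HeckeCharacter K} {M : ℕ} [NeZero M] {k : ℕ}
    {g : CuspForm (Gamma1 M) (k : ℤ)} (h : IsCMNewformOf ψ M k g) : IsNewform1 g :=
  h.1

/-- The Euler-factor matching of a CM newform of `ψ` at a prime `ℓ ∤ M`: the Hecke polynomial of
`g` at `ℓ` is `∏_{w ∣ ℓ} (X^{f(w|ℓ)} − ψ(ϖ_w))`. [cite: Ribet1977Nebentypus, §3, Thm. (3.4), Cor. (3.5)] -/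
theorem IsCMNewformOf.map_heckePolynomial_eq {ψ : HeckeCharacter K} {M : ℕ} [NeZero M] {k : ℕ}
    {g : CuspForm (Gamma1 M) (k : ℤ)} (h : IsCMNewformOf ψ M k g) {v : HeightOneSpectrum (𝓞 ℚ)}
    (hv : ¬ ((Rat.HeightOneSpectrum.primesEquiv v : Nat.Primes) : ℕ) ∣ M) :
    (heckePolynomial g (Rat.HeightOneSpectrum.primesEquiv v : Nat.Primes)).map
        (algebraMap (coeffCharField g) ℂ) =
      inducedFrobPolynomial v (fun w => X - C (ψ.valueAtUniformizer w)) :=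
  (h.2 v hv).2.2

/-- **Granted the Hecke–Shimura–Ribet fact, every Hecke character of an imaginary quadratic field of
infinity type `(k−1, 0)` or `(0, k−1)`, `k ≥ 2`, HAS a CM newform of weight `k` at some level `M`**
(the fact `Ribet1977_cmNewform_of_heckeCharacter`, repackaged through `IsCMNewformOf`). In CGS
Thm. 2.4.1 this is the existence of `θ_{ψ_b}` (`ψ_b` of LLZ type `(0, a−b)` = tree type
`(0, b−a)`, weight `k = b − a + 1 ≥ 3`). [cite: Ribet1977Nebentypus, §3, Thm. (3.4), Cor. (3.5) and Remark (3.5) (LNM 601, pp. 34–35)] -/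
theorem exists_isCMNewformOf (h : Ribet1977_cmNewform_of_heckeCharacter)
    (hK : Module.finrank ℚ K = 2) (hKr : ¬ IsTotallyReal K) {k : ℕ} (hk : 2 ≤ k)
    {ψ : HeckeCharacter K}
    (hψ : ψ.HasInfinityType (fun _ => (k : ℤ) - 1) (fun _ => 0) ∨
      ψ.HasInfinityType (fun _ => 0) (fun _ => (k : ℤ) - 1)) :
    ∃ (M : ℕ) (_ : NeZero M) (g : CuspForm (Gamma1 M) (k : ℤ)), IsCMNewformOf ψ M k g := by
  obtain ⟨M, hM, g, hg, hmatch⟩ := h K hK hKr k hk ψ hψ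
  exact ⟨M, hM, g, hg, hmatch⟩

end Literature.NumberTheory.EllipticCurves.ModularForms

/-! ## §B. Hida's Petersson norm `⟨θ, θ⟩_N` at level `N` of a form on `Γ₁(M)`, `M ∣ N` -/

namespace Literature.NumberTheory.EllipticCurves

/-- **Hida's Petersson self-product at level `N`**, `⟨g, g⟩_N := ∫_{Γ₀(N)\ℍ} |g(τ)|² y^{k−2} dx dy`
(CGS Thm. 2.2.1: "`⟨f, g⟩_N = ∫_{Γ₀(N)\𝓗} \overline{f(τ)} g(τ) dx dy` … the Petersson inner product
on `S_2(Γ₀(N))`", no volume normalisation; LLZ15 Thm. 6.1.3: `⟨g_λ, g_λ⟩_N` at a level `N`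
divisible by the level of `g_λ`), for a form `g ∈ S_k(Γ₁(M))` with `M ∣ N` whose `|g|² y^k` is
`Γ₀(M)`-invariant (any eigenform of the diamond operators, e.g. a newform): then
`∫_{Γ₀(N)\ℍ} = [Γ₀(M):Γ₀(N)] · ∫_{Γ₀(M)\ℍ} = [Γ₀(M):Γ₀(N)] / [Γ₀(M):Γ₁(M)] · peterssonProduct (Gamma1 M) k g g
= [SL₂(ℤ):Γ₀(N)] / [SL₂(ℤ):Γ₁(M)] · peterssonProduct (Gamma1 M) k g g`, by the convention of the
tree's `peterssonProduct` (`= [±Γ : Γ] · ∫_{Γ\ℍ}`, module docstring of `HeckeOperators.lean`) and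
`[Γ₀(M):Γ₁(M)] = [Γ₀(M):±Γ₁(M)]·[±Γ₁(M):Γ₁(M)]`. DEFINED by the last expression (indices in
`SL(2, ℤ)`, `Subgroup.index`); meaningful for `M ∣ N`. [cite: CastellaGrossiSkinner2025, Thm. 2.2.1 (l.813: ⟨f,g⟩_N) and Thm. 2.4.1 (l.948: ⟨θ_{ψ_b},θ_{ψ_b}⟩_N)]
[cite: LeiLoefflerZerbes2015, Thm. 6.1.3 (ii) (⟨g_λ,g_λ⟩_N)] -/
def hidaPeterssonNorm (N : ℕ) {M : ℕ} [NeZero M] {k : ℤ} (g : CuspForm (Gamma1 M) k) : ℂ :=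
  (((Gamma0 N).index : ℕ) : ℂ) / (((Gamma1 M).index : ℕ) : ℂ) * peterssonProduct (Gamma1 M) k g g

/-- Unfolding `hidaPeterssonNorm`. [cite: CastellaGrossiSkinner2025, Thm. 2.2.1 (l.813)] -/
theorem hidaPeterssonNorm_def (N : ℕ) {M : ℕ} [NeZero M] {k : ℤ} (g : CuspForm (Gamma1 M) k) :
    hidaPeterssonNorm N g =
      (((Gamma0 N).index : ℕ) : ℂ) / (((Gamma1 M).index : ℕ) : ℂ) *
        peterssonProduct (Gamma1 M) k g g :=
  rfl

end Literature.NumberTheory.EllipticCurves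

/-! ## §C. The interpolation value and the characterising predicate of `𝓛_p(f/K, Σ^{(2′)})` -/

namespace Literature.NumberTheory.EllipticCurves.CastellaGrossiSkinner2025

variable {p : ℕ} [Fact p.Prime] {K : Type} [Field K] [NumberField K] {N : ℕ}

/-- **The `p`-Euler factor `𝓔(ψ, f, 1)` of Theorem 2.4.1**, as a complex number in the variables
`α = α_p` (the unit root, in `ℂ`), `x = ψ(v̄)`, `y = ψ(v)`:
`(1 − p⁻¹ x α)(1 − x α⁻¹)(1 − y⁻¹ α⁻¹)(1 − p⁻¹ y⁻¹ α)` — verbatim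
`(1 − p⁻¹ψ(v̄)α_p)(1 − ψ(v̄)α_p⁻¹)(1 − ψ⁻¹(v)α_p⁻¹)(1 − p⁻¹ψ⁻¹(v)α_p)`.
[cite: CastellaGrossiSkinner2025, Thm. 2.4.1 (second display, l.952–954)] -/
def hidaIIEulerFactor (p : ℕ) (α x y : ℂ) : ℂ :=
  (1 - x * α / p) * (1 - x / α) * (1 - 1 / (y * α)) * (1 - α / (p * y))

/-- **The right-hand side of Theorem 2.4.1 at `ψ` of infinity type `(b, a) = (b, −c)`**, `b, c ≥ 1`,
as a complex number, given: the embedding datum `ι` and the minimal model `W` (for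
`α_p = ι(unitRoot W p)`), the primes `v`, `v̄`, the character `ψ`, the exponents `b`, `c`, the level
`Nlev` at which `N^{a+b+1}` and `⟨θ, θ⟩_N` are taken (READING FLAG `CGS-241-level`, module docstring),
a CM newform `θ` of `ψ_b` (for `⟨θ_{ψ_b}, θ_{ψ_b}⟩_N = hidaPeterssonNorm Nlev θ`) and the value
`L1 = L(f/K, ψ, 1)`:
`[i^{b+c−1} · b! · (b−1)! · Nlev^{b−c+1}] / [2^{b+c} · (2π)^{2b+1} · ⟨θ, θ⟩_{Nlev}] ·
𝓔(ψ,f,1) / [(1 − x/y)(1 − x/(p y))] · L1` with `x = ψ(v̄)`, `y = ψ(v)` (so `x/y = ψ^{1−τ}(v̄)`), i.e.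
the printed `2^{a−b} i^{b−a−1} Γ(b+1)Γ(b) N^{a+b+1} / ((2π)^{2b+1}⟨θ_{ψ_b},θ_{ψ_b}⟩_N) · 𝓔(ψ,f,1) /
((1 − ψ^{1−τ}(v̄))(1 − p⁻¹ψ^{1−τ}(v̄))) · L(f/K,ψ,1)` with `a = −c`.
[cite: CastellaGrossiSkinner2025, Thm. 2.4.1 (l.942–956) = arXiv v1 Thm. 1.4.1 (paper:arxiv-2303.04373 p0009:L1–L15)]
[cite: LeiLoefflerZerbes2015, Thm. 6.1.3 (ii)] -/
def hidaIIInterpolationValue (ι : PadicAlgCl p ≃+* ℂ) (W : WeierstrassCurve ℚ) [W.IsGloballyMinimal]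
    (v vbar : HeightOneSpectrum (𝓞 K)) (ψ : HeckeCharacter K) (b c Nlev : ℕ) {M : ℕ} [NeZero M]
    {k : ℤ} (θ : CuspForm (Gamma1 M) k) (L1 : ℂ) : ℂ :=
  let α : ℂ := ι (algebraMap ℚ_[p] (PadicAlgCl p) ((unitRoot W p : ℤ_[p]) : ℚ_[p]))
  let x : ℂ := ψ.valueAtUniformizer vbar
  let y : ℂ := ψ.valueAtUniformizer v
  (Complex.I ^ (b + c - 1) * (b.factorial : ℂ) * ((b - 1).factorial : ℂ) *
        (Nlev : ℂ) ^ ((b : ℤ) - c + 1)) /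
      ((2 : ℂ) ^ (b + c) * (2 * Real.pi : ℂ) ^ (2 * b + 1) * hidaPeterssonNorm Nlev θ) *
    (hidaIIEulerFactor p α x y / ((1 - x / y) * (1 - x / (p * y)))) * L1

/-- **The interpolation property of Hida's type-II′ two-variable `p`-adic Rankin `L`-series
`𝓛_p(f/K, Σ^{(2′)}) = G/H`** (CGS Thm. 2.4.1 = LLZ15 Thm. 6.1.3 (ii) with `v ↔ v̄`), as a
CHARACTERISING PREDICATE on a pair `(H, G)` of two-variable series over `𝒪_{ℂ_p}` in the variables
`1 + T_i ↔ γ_i` of the pair `(κ₁, κ₂)`: for every idelic Hecke character `ψ` of `K` of tree infinity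
type `(−b, c)` (= CGS type `(b, −c) ∈ Σ^{(2′)}`), `b, c ≥ 1`, unramified at every finite place, with
`p`-adic avatar `r` (w.r.t. `ι`) factoring through the pair; for every CM newform `θ` of
`ψ_b = ψ|·|^{−b}` on `Γ₁(M)` of weight `b + c + 1` (`IsCMNewformOf`); for every entire `L` agreeing
with the Euler product `L(f/K, ψ, s)` on `re s > c + 2`; and for every value `h` of `H` at the point
`(r(γ₁) − 1, r(γ₂) − 1)`: the value of `G` there is `h · ι⁻¹(RHS)`, `RHS = hidaIIInterpolationValue …
(N·M) θ (L 1)` (level `N·M`, flag `CGS-241-level`; `N` = the level of `f`). Parameters: `ι`, the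
minimal model `W` (unit root), `f ∈ S_2(Γ₀(N))` (meant: the newform of `W`, `N = N_E`), the primes
`v` (meant: induced by `ι`), `v̄`, the pair and its generators. A predicate — no existence and no
integrality is claimed (that is `thm241_exists_isHidaRankinLFunctionII`).
[cite: CastellaGrossiSkinner2025, Thm. 2.4.1 (l.942–960)] [cite: LeiLoefflerZerbes2015, Thm. 6.1.3 (ii)] -/
def IsHidaRankinLFunctionII (ι : PadicAlgCl p ≃+* ℂ) (W : WeierstrassCurve ℚ) [W.IsGloballyMinimal]
    (f : CuspForm (Gamma0 N) 2) (v vbar : HeightOneSpectrum (𝓞 K)) (κ₁ κ₂ : ZpExtension K p)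
    (γ₁ γ₂ : absoluteGaloisGroup K) (H G : PowerSeries (PowerSeries (PadicComplexInt p))) : Prop :=
  ∀ (ψ : HeckeCharacter K) (b c : ℕ), 1 ≤ b → 1 ≤ c →
    ψ.HasInfinityType (fun _ => -(b : ℤ)) (fun _ => (c : ℤ)) →
    (∀ w : HeightOneSpectrum (𝓞 K), ψ.IsUnramifiedAt w) →
    ∀ (r : FramedGaloisRep K (PadicAlgCl p) 1), IsPAdicAvatarOf ι ψ r → FactorsThroughPair κ₁ κ₂ r →
    ∀ (M : ℕ) [NeZero M] (θ : CuspForm (Gamma1 M) ((b + c + 1 : ℕ) : ℤ)),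
      IsCMNewformOf (ψ * (HeckeCharacter.normCharacter K ^ b)⁻¹) M (b + c + 1) θ →
    ∀ (L : ℂ → ℂ), Differentiable ℂ L →
      (∀ s : ℂ, (c : ℝ) + 2 < s.re → L s = rankinSelbergEulerProductHecke f ψ s) →
    ∀ (h : ℂ_[p]), IntSeries.HasValueAt₂ H (avatarValueAt r γ₁ - 1) (avatarValueAt r γ₂ - 1) h →
      IntSeries.HasValueAt₂ G (avatarValueAt r γ₁ - 1) (avatarValueAt r γ₂ - 1)
        (h * ((ι.symm (hidaIIInterpolationValue ι W v vbar ψ b c (N * M) θ (L 1)) :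
          PadicAlgCl p) : ℂ_[p]))

/-! ### API -/

section API

variable {ι : PadicAlgCl p ≃+* ℂ} {W : WeierstrassCurve ℚ} [W.IsGloballyMinimal]
  {f : CuspForm (Gamma0 N) 2} {v vbar : HeightOneSpectrum (𝓞 K)} {κ₁ κ₂ : ZpExtension K p}
  {γ₁ γ₂ : absoluteGaloisGroup K} {H G : PowerSeries (PowerSeries (PadicComplexInt p))}

/-- Unfolding `IsHidaRankinLFunctionII` at one character of the typed range: the prescribed value of
`G` at `(r(γ₁) − 1, r(γ₂) − 1)` given the value `h` of `H` there.
[cite: CastellaGrossiSkinner2025, Thm. 2.4.1 (l.942–960)] -/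
theorem IsHidaRankinLFunctionII.hasValueAt₂
    (hG : IsHidaRankinLFunctionII ι W f v vbar κ₁ κ₂ γ₁ γ₂ H G)
    {ψ : HeckeCharacter K} {b c : ℕ} (hb : 1 ≤ b) (hc : 1 ≤ c)
    (hinf : ψ.HasInfinityType (fun _ => -(b : ℤ)) (fun _ => (c : ℤ)))
    (hunr : ∀ w : HeightOneSpectrum (𝓞 K), ψ.IsUnramifiedAt w)
    {r : FramedGaloisRep K (PadicAlgCl p) 1} (hr : IsPAdicAvatarOf ι ψ r)
    (hκ : FactorsThroughPair κ₁ κ₂ r) {M : ℕ} [NeZero M]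
    {θ : CuspForm (Gamma1 M) ((b + c + 1 : ℕ) : ℤ)}
    (hθ : IsCMNewformOf (ψ * (HeckeCharacter.normCharacter K ^ b)⁻¹) M (b + c + 1) θ)
    {L : ℂ → ℂ} (hL : Differentiable ℂ L)
    (hL' : ∀ s : ℂ, (c : ℝ) + 2 < s.re → L s = rankinSelbergEulerProductHecke f ψ s)
    {h : ℂ_[p]} (hh : IntSeries.HasValueAt₂ H (avatarValueAt r γ₁ - 1) (avatarValueAt r γ₂ - 1) h) :
    IntSeries.HasValueAt₂ G (avatarValueAt r γ₁ - 1) (avatarValueAt r γ₂ - 1)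
      (h * ((ι.symm (hidaIIInterpolationValue ι W v vbar ψ b c (N * M) θ (L 1)) :
        PadicAlgCl p) : ℂ_[p])) :=
  hG ψ b c hb hc hinf hunr r hr hκ M θ hθ L hL hL' h hh

/-- The prescribed value is unique: any value `g` of `G` at a point of the typed range where `H` has
the value `h` equals `h · ι⁻¹(RHS)`. [cite: CastellaGrossiSkinner2025, Thm. 2.4.1 (l.942–960)] -/
theorem IsHidaRankinLFunctionII.eq_of_hasValueAt₂
    (hG : IsHidaRankinLFunctionII ι W f v vbar κ₁ κ₂ γ₁ γ₂ H G)
    {ψ : HeckeCharacter K} {b c : ℕ} (hb : 1 ≤ b) (hc : 1 ≤ c)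
    (hinf : ψ.HasInfinityType (fun _ => -(b : ℤ)) (fun _ => (c : ℤ)))
    (hunr : ∀ w : HeightOneSpectrum (𝓞 K), ψ.IsUnramifiedAt w)
    {r : FramedGaloisRep K (PadicAlgCl p) 1} (hr : IsPAdicAvatarOf ι ψ r)
    (hκ : FactorsThroughPair κ₁ κ₂ r) {M : ℕ} [NeZero M]
    {θ : CuspForm (Gamma1 M) ((b + c + 1 : ℕ) : ℤ)}
    (hθ : IsCMNewformOf (ψ * (HeckeCharacter.normCharacter K ^ b)⁻¹) M (b + c + 1) θ)
    {L : ℂ → ℂ} (hL : Differentiable ℂ L)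
    (hL' : ∀ s : ℂ, (c : ℝ) + 2 < s.re → L s = rankinSelbergEulerProductHecke f ψ s)
    {h g : ℂ_[p]} (hh : IntSeries.HasValueAt₂ H (avatarValueAt r γ₁ - 1) (avatarValueAt r γ₂ - 1) h)
    (hg : IntSeries.HasValueAt₂ G (avatarValueAt r γ₁ - 1) (avatarValueAt r γ₂ - 1) g) :
    g = h * ((ι.symm (hidaIIInterpolationValue ι W v vbar ψ b c (N * M) θ (L 1)) :
      PadicAlgCl p) : ℂ_[p]) :=
  hg.unique (hG.hasValueAt₂ hb hc hinf hunr hr hκ hθ hL hL' hh)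

/-- Values of a constant multiple: if `X` has the value `w` at `(x, y)` then `u · X` (constant
`u ∈ 𝒪_{ℂ_p}`, i.e. `C (C u) * X`) has the value `u · w` there (linearity of evaluation of a
two-variable measure / power series at a character, de Shalit II.4.17 (54)). [cite: deShalit1987, II.4.17 (54) (store chunk 78)] -/
theorem _root_.Literature.NumberTheory.EllipticCurves.IntSeries.HasValueAt₂.const_mul
    {X : PowerSeries (PowerSeries (PadicComplexInt p))} {x y w : ℂ_[p]}
    (hX : IntSeries.HasValueAt₂ X x y w) (u : PadicComplexInt p) :
    IntSeries.HasValueAt₂ (PowerSeries.C (PowerSeries.C u) * X) x y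
      (((u : PadicComplexInt p) : ℂ_[p]) * w) := by
  unfold IntSeries.HasValueAt₂ at hX ⊢
  have h2 : (fun k : ℕ × ℕ ↦
      (((PowerSeries.coeff k.2 (PowerSeries.coeff k.1 (PowerSeries.C (PowerSeries.C u) * X)) :
        PadicComplexInt p) : ℂ_[p]) * x ^ k.1 * y ^ k.2)) =
      fun k : ℕ × ℕ ↦ ((u : PadicComplexInt p) : ℂ_[p]) *
        ((((PowerSeries.coeff k.2 (PowerSeries.coeff k.1 X)) : PadicComplexInt p) : ℂ_[p]) *
          x ^ k.1 * y ^ k.2) := by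
    funext k
    simp only [PowerSeries.coeff_C_mul]
    push_cast
    ring
  rw [h2]
  exact hX.mul_left _

/-- Values of a constant multiple by `u` with `u ≠ 0` in `ℂ_p`: `u · X` has the value `w` at `(x, y)`
iff `X` has the value `u⁻¹ w` there (de Shalit II.4.17 (54): evaluation is linear). [cite: deShalit1987, II.4.17 (54) (store chunk 78)] -/
theorem _root_.Literature.NumberTheory.EllipticCurves.IntSeries.hasValueAt₂_const_mul_iff
    {X : PowerSeries (PowerSeries (PadicComplexInt p))} {x y w : ℂ_[p]} {u : PadicComplexInt p}
    (hu : ((u : PadicComplexInt p) : ℂ_[p]) ≠ 0) :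
    IntSeries.HasValueAt₂ (PowerSeries.C (PowerSeries.C u) * X) x y w ↔
      IntSeries.HasValueAt₂ X x y (((u : PadicComplexInt p) : ℂ_[p])⁻¹ * w) := by
  constructor
  · intro hw
    unfold IntSeries.HasValueAt₂ at hw ⊢
    have h2 : (fun k : ℕ × ℕ ↦
        (((PowerSeries.coeff k.2 (PowerSeries.coeff k.1 X)) : PadicComplexInt p) : ℂ_[p]) *
          x ^ k.1 * y ^ k.2) =
        fun k : ℕ × ℕ ↦ ((u : PadicComplexInt p) : ℂ_[p])⁻¹ *
          ((((PowerSeries.coeff k.2 (PowerSeries.coeff k.1 (PowerSeries.C (PowerSeries.C u) * X))) :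
            PadicComplexInt p) : ℂ_[p]) * x ^ k.1 * y ^ k.2) := by
      funext k
      simp only [PowerSeries.coeff_C_mul]
      push_cast
      field_simp
    rw [h2]
    exact hw.mul_left _
  · intro hw
    have := hw.const_mul u
    simpa [← mul_assoc, mul_inv_cancel₀ hu] using this

/-- **The frame pins the RATIO `G/H`, not the pair**: if `(H, G)` is a frame then so is
`(u · H, u · G)` for every constant `u ∈ 𝒪_{ℂ_p}` nonzero in `ℂ_p` (e.g. the image of a unit, or of
any nonzero element, of `ℤ_p`) — "`𝓛_p(f/K, Σ^{(2′)}) ∈ Frac Λ_K`" is an element of the fraction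
field, represented by any such pair. [cite: CastellaGrossiSkinner2025, Thm. 2.4.1 ("∈ Frac Λ_K", l.944)] -/
theorem IsHidaRankinLFunctionII.const_mul
    (hG : IsHidaRankinLFunctionII ι W f v vbar κ₁ κ₂ γ₁ γ₂ H G) {u : PadicComplexInt p}
    (hu : ((u : PadicComplexInt p) : ℂ_[p]) ≠ 0) :
    IsHidaRankinLFunctionII ι W f v vbar κ₁ κ₂ γ₁ γ₂
      (PowerSeries.C (PowerSeries.C u) * H) (PowerSeries.C (PowerSeries.C u) * G) := by
  intro ψ b c hb hc hinf hunr r hr hκ M _ θ hθ L hL hL' h hh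
  have hh' := (IntSeries.hasValueAt₂_const_mul_iff hu).mp hh
  have hGv := hG.hasValueAt₂ hb hc hinf hunr hr hκ hθ hL hL' hh'
  refine (IntSeries.hasValueAt₂_const_mul_iff hu).mpr ?_
  simpa [mul_assoc] using hGv

end API

/-! ## §D. Theorem 2.4.1 — named existence fact (`∈ Frac Λ_K`) -/

/-- **Castella–Grossi–Skinner, Math. Ann. 393 (2025), Theorem 2.4.1 (`thm:Gr`, final TeX l.942–960;
arXiv v1 Thm. 1.4.1) — Hida's type-II′ two-variable `p`-adic Rankin `L`-series
`𝓛_p(f/K, Σ^{(2′)}) ∈ Frac Λ_K` EXISTS; named fact.** PRINT: "There exists an element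
`𝓛_p(f/K, Σ^{(2′)}) ∈ Frac Λ_K` such that for every character `ξ` of `Γ_K` crystalline at both `v` and
`v̄`, and of infinity type `(b,a)` with `a ≤ −1` and `b ≥ 1`, we have [the display of
`hidaIIInterpolationValue`]", proof: "another instance of Hida's `p`-adic Rankin `L`-series, as
explained in [LLZ-K, Thm. 6.1.3] (… reversed the roles of `v` and `v̄` …)". Standing hypotheses of
§2 (l.697–705) as binders: `W` a globally minimal model of the elliptic curve `E/ℚ` of conductor `N`
(the level of its newform `f`, `IsNewformOf W f`), `p ∤ 2N` of good ORDINARY reduction (`2 < p`,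
`Rank1Residual.GoodOrd W p`; `p ∤ N` is part of good reduction), `K` imaginary quadratic with
`(D_K, N) = 1`, (spl) `p = v v̄` split (two primes over `p`, `v ≠ v̄` both above `p`) with `v` the
prime induced by the embedding datum `ι : ℚ̄_p ≃ ℂ` (`k ∈ v ↔ |ι⁻¹(k)|_p < 1`, reading `K ⊂ ℂ` through
Mathlib's embedding of its infinite place — the clause of `castella2018_exists_isBDPLFunction` and
`Rubin1991.thm41_exists_katzMeasure₂_charIdeal_eq`), and an adapted generator pair
`(κ₁, κ₂; γ₁, γ₂)` presenting `Γ_K` (`ZpExtension.IsTopGeneratorPair`). CONCLUSION: there are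
`H, G ∈ Λ_K = ℤ_p⟦T₁, T₂⟧` with `H ≠ 0` such that, read in `𝒪_{ℂ_p}⟦T₁, T₂⟧` along every
structure-compatible `J : ℤ_p →+* 𝒪_{ℂ_p}`, the pair `(H, G)` satisfies `IsHidaRankinLFunctionII`
(`𝓛 = G/H`; flags `CGS-241-level`, `CGS-241-orientation` of the module docstring). PUBLISHED
(Math. Ann. 2025; proof = citation of LLZ15, Compositio 2015). +1 declared debt (Hida's `p`-adic
Rankin–Selberg measure has no tree-level construction).
[cite: CastellaGrossiSkinner2025, Thm. 2.4.1 (§2.4, l.942–960; arXiv v1 Thm. 1.4.1 = paper:arxiv-2303.04373 p0009:L1–L15), with §2 standing hypotheses (l.697–705)]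
[cite: LeiLoefflerZerbes2015, Thm. 6.1.3 (ii) (arXiv:1311.0175 §6.1, p0014:L26–L44)] -/
def thm241_exists_isHidaRankinLFunctionII : Prop :=
  ∀ {p : ℕ} [Fact p.Prime] (ι : PadicAlgCl p ≃+* ℂ) (W : WeierstrassCurve ℚ) [W.IsElliptic]
    [W.IsGloballyMinimal] (K : Type) [Field K] [NumberField K] (v vbar : HeightOneSpectrum (𝓞 K))
    (κ₁ κ₂ : ZpExtension K p) (γ₁ γ₂ : absoluteGaloisGroup K)
    {N : ℕ} [NeZero N] {f : CuspForm (Gamma0 N) 2} (_ : IsNewformOf W f),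
    2 < p → Rank1Residual.GoodOrd W p →
    IsImaginaryQuadratic K → IsCoprime (N : ℤ) (discr K) →
    ((Ideal.span {(p : ℤ)}).primesOver (𝓞 K)).ncard = 2 →
    ((p : ℕ) : 𝓞 K) ∈ v.asIdeal → ((p : ℕ) : 𝓞 K) ∈ vbar.asIdeal → vbar ≠ v →
    (∀ (w : InfinitePlace K) (k : 𝓞 K), k ∈ v.asIdeal ↔ ‖ι.symm (w.embedding (k : K))‖ < 1) →
    ZpExtension.IsTopGeneratorPair κ₁ κ₂ γ₁ γ₂ →
    ∃ (H G : IwasawaAlgebra₂ p), H ≠ 0 ∧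
      ∀ (J : ℤ_[p] →+* PadicComplexInt p),
        (∀ x : ℤ_[p], ((J x : PadicComplexInt p) : ℂ_[p]) = ((x : ℚ_[p]) : ℂ_[p])) →
        IsHidaRankinLFunctionII ι W f v vbar κ₁ κ₂ γ₁ γ₂
          (PowerSeries.map (PowerSeries.map J) H) (PowerSeries.map (PowerSeries.map J) G)

/-- Unfolding corollary of Thm. 2.4.1: under its hypotheses, a frame `(H, G)` over `𝒪_{ℂ_p}` with
`H` the image of a NONZERO element of `Λ_K` exists (along any given compatible `J`).
[cite: CastellaGrossiSkinner2025, Thm. 2.4.1 (l.942–960)] -/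
theorem thm241_exists_isHidaRankinLFunctionII.exists_frame
    (h241 : thm241_exists_isHidaRankinLFunctionII) (ι : PadicAlgCl p ≃+* ℂ)
    (W : WeierstrassCurve ℚ) [W.IsElliptic] [W.IsGloballyMinimal]
    {v vbar : HeightOneSpectrum (𝓞 K)} {κ₁ κ₂ : ZpExtension K p} {γ₁ γ₂ : absoluteGaloisGroup K}
    [NeZero N] {f : CuspForm (Gamma0 N) 2} (hf : IsNewformOf W f) (hp : 2 < p)
    (hord : Rank1Residual.GoodOrd W p) (hK : IsImaginaryQuadratic K)
    (hND : IsCoprime (N : ℤ) (discr K)) (hspl : ((Ideal.span {(p : ℤ)}).primesOver (𝓞 K)).ncard = 2)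
    (hv : ((p : ℕ) : 𝓞 K) ∈ v.asIdeal) (hvbar : ((p : ℕ) : 𝓞 K) ∈ vbar.asIdeal) (hne : vbar ≠ v)
    (hι : ∀ (w : InfinitePlace K) (k : 𝓞 K), k ∈ v.asIdeal ↔ ‖ι.symm (w.embedding (k : K))‖ < 1)
    (hγ : ZpExtension.IsTopGeneratorPair κ₁ κ₂ γ₁ γ₂) {J : ℤ_[p] →+* PadicComplexInt p}
    (hJ : ∀ x : ℤ_[p], ((J x : PadicComplexInt p) : ℂ_[p]) = ((x : ℚ_[p]) : ℂ_[p])) :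
    ∃ (H G : IwasawaAlgebra₂ p), H ≠ 0 ∧
      IsHidaRankinLFunctionII ι W f v vbar κ₁ κ₂ γ₁ γ₂
        (PowerSeries.map (PowerSeries.map J) H) (PowerSeries.map (PowerSeries.map J) G) := by
  obtain ⟨H, G, hH, hHG⟩ := h241 ι W K v vbar κ₁ κ₂ γ₁ γ₂ hf hp hord hK hND hspl hv hvbar hne hι hγ
  exact ⟨H, G, hH, hHG J hJ⟩


end Literature.NumberTheory.EllipticCurves.CastellaGrossiSkinner2025
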